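import Summits.BirchSwinnertonDyer.BirchSwinnertonDyer.Theorems.QuadraticBranchSignedControlPlusEtaNonsurjThetaFunctionalEquationTwistParity
import Summits.BirchSwinnertonDyer.BirchSwinnertonDyer.Theorems.QuadraticBranchSignedControlPlusEtaCMRankOneOfBT26
import HarnessLib

/-!
# Route `QuadraticBranchSignedControl` (rung K8, cell `bsd-potss`), residual crux `PlusEtaMainConjectureNonsurj`
# (stmt-BirchSwinnertonDyer-19606): THE FUNCTIONAL EQUATION ON THE QUADRATIC BRANCH, XLIV — THE ORDER OF `Char X⁺(V/K_∞)^η` AT `T = 0` ON THE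
# CM ROWS IS THE ANALYTIC ONE: **on a CM row whose additive partner `W = V^{(p*)}` has EVEN analytic rank and `L_p⁺(V, η, 0) = 0` (i.e.
# `L(W,1) = 0`), `T² ∣ Char X⁺(V/K_∞)^η`; with ODD analytic rank, `ord_T Char X⁺(V/K_∞)^η` is odd and `T ∣ Char`; and `Char(0) = 0 ⟺ L_p⁺(V,η,0) = 0`**
# — granted Burungale–Tian Thm. 2.6 ∘ Kobayashi (`h26`), Kobayashi Thm. 2.2 at `η` (`h22`) and modularity (`exists_isNewformOf`), with NO
# hypothesis on `W(ℚ)` (seat `bsd-potss-k8eta-c2` g32; kernel; conditional on the displayed named facts)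

WHY. The census repair P-32A/P-32F of this seat (kit j340231): of the 44 level-4 rows of the plus-branch tables P-29R … P-31G — ALL of them CM —
ELEVEN have a partner `W` of analytic rank `2` and one (cm27a4_157) of analytic rank `3`; the folds P-30Z/P-30M/P-31F/P-31G booked them with the
sign-derived `r₀ ∈ {0, 1}`. On the analytic side the tree already reads the correct order (`two_le_order_of_sign_eq_one_…`, Part IX;
`even_order_plus_iff_even_analyticRank_twist`, Part XIV). THIS Part carries the order to the SELMER side on the CM rows, where seat k8q-c2 g4
(`EtaCMRankOneBT26.order_charGenerator_eq_order_of_cm`, p479848) proved `ord_T g = ord_T L_p⁺(V,η,X)` for every generator `g` of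
`Char X⁺(V/K_∞)^η` from Burungale–Tian's equality up to powers of `p`: so (§126) `2 ≤ ord_T g` and `T² ∣ g` on the even rows with `L(W,1) = 0`,
`ord_T g` odd and `T ∣ g` on the odd rows, `g(0) = 0 ⟺ Lη(0) = 0` on every CM row — by PRINT, with no Mordell–Weil input (on the rank-`2`
rows the η-rank bound `T^{rank W} ∣ Char` of Part XXXVIII §112 needs `rank W(ℚ) = 2`; here the analytic rank suffices).

WHAT (kernel; CONDITIONAL on `h26`, `h22`, `exists_isNewformOf` in hypothesis position; the newform `f` is taken at level `N_V = V.conductorNorm ℤ`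
— Part XIV's frame — which is where `IsNewformOf V f` lives). §126 `one_le_order_toNat_of_constantCoeff_eq_zero`,
`two_le_order_toNat_plus_of_even_analyticRank_twist` (analytic, any row), **`two_le_order_toNat_charGenerator_of_cm_of_even_analyticRank_twist`**,
**`odd_order_toNat_charGenerator_of_cm_of_odd_analyticRank_twist`**, `constantCoeff_charGenerator_eq_zero_iff_of_cm`.

HONEST FRAMING (cell `bsd-potss`; FULL-BSD rank ≤ 1 programme, HUMAN RULING D-0036/D-0074): THEOREMS ONLY — no definition, no named fact
minted, no `sorry`, axioms standard; CONDITIONAL on published theorems NOT proved in the tree (`h26`, `h22`, modularity). The rows concerned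
(`r_an(W) ≥ 2`) lie OUTSIDE the programme's analytic-rank-`≤ 1` universe but INSIDE the crux as stated (no rank binder); nothing here proves
the `μ`-part, the crux, a stub, or `BSD(W,p)` for any pair; nothing is booked. `--supports stmt-BirchSwinnertonDyer-19606`.

References: [BurungaleTian2026] Thm. 2.6 (p. 5); [Kobayashi2003] §4 Even main conjecture (p. 8), Thm. 2.2 (p. 5), Thm. 3.2 and (3.4)/(3.6) (p. 7);
[MazurTateTeitelbaum1986Invent] §I.17 (functional equation); [SilvermanAEC2009] C.16 (parity of the analytic rank and the root number);
[Washington1997] §7.1.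
-/

set_option linter.dupNamespace false

noncomputable section

open scoped Classical MatrixGroups ModularForm Topology

open PowerSeries CongruenceSubgroup WeierstrassCurve Field Literature.NumberTheory.EllipticCurves
  Literature.NumberTheory.EllipticCurves.ModularForms Literature.NumberTheory.GaloisRepresentations ZpExtension
open Literature.NumberTheory.EllipticCurves.IwasawaAlgebra
open Summit.BirchSwinnertonDyer.Rank1Residual.Additive

namespace Summit.BirchSwinnertonDyer.BirchSwinnertonDyer.Theorems.EtaThetaFunctionalEquation

variable {p : ℕ} [hp : Fact p.Prime]

/-! ## §126 The order at `T = 0` of `Char X⁺(V/K_∞)^η` on the CM rows -/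

/-- A nonzero power series with vanishing constant term has `1 ≤ ord_T`. [folklore] -/
theorem one_le_order_toNat_of_constantCoeff_eq_zero {L : IwasawaAlgebra p} (hL0 : L ≠ 0) (h0 : PowerSeries.constantCoeff L = 0) :
    1 ≤ L.order.toNat := by
  have h1 : (1 : ℕ∞) ≤ L.order := by
    refine PowerSeries.nat_le_order L 1 fun i hi ↦ ?_
    have hi0 : i = 0 := by omega
    subst hi0
    rw [PowerSeries.coeff_zero_eq_constantCoeff]; exact h0
  have hfin : L.order ≠ ⊤ := (PowerSeries.order_finite_iff_ne_zero.mpr hL0).ne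
  have h := ENat.toNat_le_toNat h1 hfin
  simpa using h

/-- `T^n ∣ L` once `n ≤ ord_T L`. [folklore] -/
theorem X_pow_dvd_of_le_order_toNat {L : IwasawaAlgebra p} {n : ℕ} (hn : n ≤ L.order.toNat) : X ^ n ∣ L := by
  refine (PowerSeries.X_pow_dvd_iff).mpr fun m hm ↦ PowerSeries.coeff_of_lt_order m ?_
  exact lt_of_lt_of_le (by exact_mod_cast lt_of_lt_of_le hm hn) (ENat.coe_toNat_le_self _)

section Analytic

variable {V : WeierstrassCurve ℚ} [V.IsElliptic] [NeZero (V.conductorNorm ℤ)] {f : CuspForm (Gamma0 (V.conductorNorm ℤ)) 2}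
  [V.IsGloballyMinimal]

/-- **Analytic side, any row: `L_p⁺(V, η, 0) = 0` and `r_an(V^{(p*)})` even ⟹ `2 ≤ ord_T L_p⁺(V, η, X)`** — the order is `≥ 1` (vanishing constant
term) and has the parity of the analytic rank of the twist (Part XIV `even_order_plus_iff_even_analyticRank_twist`, from the `Λ`-adic functional
equation and the sign law), so it is `≥ 2`. Modularity (`exists_isNewformOf`) in hypothesis position; `V` good at `p ≥ 5` with `a_p(V) = 0`.
[cite: MazurTateTeitelbaum1986Invent, §I.17] [cite: SilvermanAEC2009, C.16 Thm. 16.3 and remark (p. 451)] [cite: Kobayashi2003, (3.6) (p. 7)] -/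
theorem two_le_order_toNat_plus_of_even_analyticRank_twist (hmod : exists_isNewformOf) (hp5 : 5 ≤ p)
    (hgood : V.HasGoodReductionAtPrime p) (hap : V.frobeniusTrace p = 0) (hf : IsNewformOf V f) (ϖ : ℚ) {Lη : IwasawaAlgebra p}
    (hL : IsQuadraticBranchPlusLFunction f p ϖ Lη) (hL0 : Lη ≠ 0) (h0 : PowerSeries.constantCoeff Lη = 0)
    (heven : Even (V.quadraticTwist ((((-1 : ℤ) ^ (p / 2) * p : ℤ)) : ℚ)).analyticRank) : 2 ≤ Lη.order.toNat := by
  have h1 := one_le_order_toNat_of_constantCoeff_eq_zero hL0 h0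
  have hev : Even Lη.order.toNat := (even_order_plus_iff_even_analyticRank_twist hmod hp5 hgood hap hf ϖ hL hL0).mpr heven
  obtain ⟨k, hk⟩ := hev
  omega

end Analytic

section CM

variable {K₀ : Type} [Field K₀] [NumberField K₀] [IsCyclotomicExtension {p} ℚ K₀] [(galRange (K := ℚ) K₀).Normal]
  {ηq : absoluteGaloisGroup ℚ →* ℤˣ} {V : WeierstrassCurve ℚ} [V.IsElliptic] [NeZero (V.conductorNorm ℤ)]
  {f : CuspForm (Gamma0 (V.conductorNorm ℤ)) 2} [V.IsGloballyMinimal]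
  {κ : ZpExtension ℚ p} {γ : absoluteGaloisGroup ℚ}

/-- **`T² ∣ Char X⁺(V/K_∞)^η` ON A CM ROW OF EVEN ANALYTIC RANK WITH `L(W,1) = 0`.** Frame = the node's (`V` CM, globally minimal, good at
`p ≥ 5`, `a_p(V) = 0`, `f`, `ϖ` matched to the parity of `η`, `ηq` the quadratic character of `Gal(ℚ(μ_p)/ℚ)`, `κ`, `γ` matching the
variable, `D` ANY dual datum of `Sel⁺(V/K_∞)^η`, `g` ANY generator of `Char(D.X)`); inputs: `Lη = L_p⁺(V, η, X) ≠ 0` with `Lη(0) = 0` (the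
value half: `L(V^{(p*)}, 1) = 0`) and `r_an(V^{(p*)})` EVEN. THEN **`2 ≤ ord_T g` and `T² ∣ g`** — k8q-c2 g4's `ord_T g = ord_T Lη`
(Burungale–Tian ∘ Kobayashi) and the analytic `2 ≤ ord_T Lη`. No hypothesis on `W(ℚ)`: the eleven `r_an(W) = 2` rows of P-32A (all CM) carry
two zeros of `Char X⁺(V/K_∞)^η` at `T = 0` by print. CONDITIONAL on `h26`, `h22`, `hmod`; nothing booked.
[cite: BurungaleTian2026, Thm. 2.6 (p. 5)] [cite: Kobayashi2003, §4 Even main conjecture (p. 8), Thm. 2.2 (p. 5)] [cite: SilvermanAEC2009, C.16 Thm. 16.3] -/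
theorem two_le_order_toNat_charGenerator_of_cm_of_even_analyticRank_twist
    (h26 : BurungaleTian2026.thm26_etaKatoSequences_charIdeal_upToP_of_cm)
    (h22 : Kobayashi2003.thm22_etaSignedSelmerDual_finite_torsion) (hmod : exists_isNewformOf) (hCM : V.HasCM)
    (hηK : ∀ σ ∈ galRange (K := ℚ) K₀, ηq σ = 1) (hη1 : ηq ≠ 1) (hp5 : 5 ≤ p) (hgood : V.HasGoodReductionAtPrime p)
    (hap : V.frobeniusTrace p = 0) (hf : IsNewformOf V f) (ϖ : ℚ)
    (hϖ : if Even (p / 2) then (ϖ : ℝ) * V.realPeriodRat = plusPeriod f else (ϖ : ℝ) * V.imaginaryPeriodRat = minusPeriod f)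
    {Lη : IwasawaAlgebra p} (hL : IsQuadraticBranchPlusLFunction f p ϖ Lη) (hL0 : Lη ≠ 0) (h0 : PowerSeries.constantCoeff Lη = 0)
    (heven : Even (V.quadraticTwist ((((-1 : ℤ) ^ (p / 2) * p : ℤ)) : ℚ)).analyticRank)
    (hκ : κ.IsCyclotomic) (hγ : κ.IsTopGenerator γ) (hγK : γ ∈ galRange (K := ℚ) K₀) (hγc : IsCyclotomicVariable p γ)
    (D : EtaSignedSelmerDualData V κ K₀ ℚ_[p] ηq γ 1) {g : IwasawaAlgebra p} (hg : D.charIdeal = Ideal.span {g}) :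
    2 ≤ g.order.toNat ∧ X ^ 2 ∣ g := by
  have hp2 : p ≠ 2 := by omega
  have hord : g.order = Lη.order :=
    EtaCMRankOneBT26.order_charGenerator_eq_order_of_cm h26 h22 hCM hηK hη1 hp2 hgood hap hf ϖ hϖ Lη hL hκ hγ hγK hγc D hg
  have h2 : 2 ≤ g.order.toNat := by
    rw [hord]; exact two_le_order_toNat_plus_of_even_analyticRank_twist hmod hp5 hgood hap hf ϖ hL hL0 h0 heven
  exact ⟨h2, X_pow_dvd_of_le_order_toNat h2⟩

/-- **ODD ORDER ON A CM ROW OF ODD ANALYTIC RANK: `ord_T Char X⁺(V/K_∞)^η` is odd and `T ∣ Char`.** Same frame; input: `r_an(V^{(p*)})` ODD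
(then `Lη(0) = 0` automatically, Part XIV `constantCoeff_plus_eq_zero_of_odd_analyticRank_twist`). So on the 27 rank-one rows AND the
rank-three row cm27a4_157 of P-32A the Selmer-side order at `T = 0` is odd (`≥ 1`; `= 3` on cm27a4_157 iff the analytic order is `3`).
CONDITIONAL on `h26`, `h22`, `hmod`; nothing booked. [cite: BurungaleTian2026, Thm. 2.6 (p. 5)] [cite: Kobayashi2003, §4 (p. 8), Thm. 2.2 (p. 5), (3.6) (p. 7)]
[cite: SilvermanAEC2009, C.16 Thm. 16.3] -/
theorem odd_order_toNat_charGenerator_of_cm_of_odd_analyticRank_twist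
    (h26 : BurungaleTian2026.thm26_etaKatoSequences_charIdeal_upToP_of_cm)
    (h22 : Kobayashi2003.thm22_etaSignedSelmerDual_finite_torsion) (hmod : exists_isNewformOf) (hCM : V.HasCM)
    (hηK : ∀ σ ∈ galRange (K := ℚ) K₀, ηq σ = 1) (hη1 : ηq ≠ 1) (hp5 : 5 ≤ p) (hgood : V.HasGoodReductionAtPrime p)
    (hap : V.frobeniusTrace p = 0) (hf : IsNewformOf V f) (ϖ : ℚ)
    (hϖ : if Even (p / 2) then (ϖ : ℝ) * V.realPeriodRat = plusPeriod f else (ϖ : ℝ) * V.imaginaryPeriodRat = minusPeriod f)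
    {Lη : IwasawaAlgebra p} (hL : IsQuadraticBranchPlusLFunction f p ϖ Lη) (hL0 : Lη ≠ 0)
    (hodd : Odd (V.quadraticTwist ((((-1 : ℤ) ^ (p / 2) * p : ℤ)) : ℚ)).analyticRank)
    (hκ : κ.IsCyclotomic) (hγ : κ.IsTopGenerator γ) (hγK : γ ∈ galRange (K := ℚ) K₀) (hγc : IsCyclotomicVariable p γ)
    (D : EtaSignedSelmerDualData V κ K₀ ℚ_[p] ηq γ 1) {g : IwasawaAlgebra p} (hg : D.charIdeal = Ideal.span {g}) :
    Odd g.order.toNat ∧ X ∣ g := by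
  have hp2 : p ≠ 2 := by omega
  have hord : g.order = Lη.order :=
    EtaCMRankOneBT26.order_charGenerator_eq_order_of_cm h26 h22 hCM hηK hη1 hp2 hgood hap hf ϖ hϖ Lη hL hκ hγ hγK hγc D hg
  have hnev : ¬ Even Lη.order.toNat := fun h ↦
    (Nat.not_even_iff_odd.mpr hodd) ((even_order_plus_iff_even_analyticRank_twist hmod hp5 hgood hap hf ϖ hL hL0).mp h)
  have hoddL : Odd Lη.order.toNat := Nat.not_even_iff_odd.mp hnev
  refine ⟨by rw [hord]; exact hoddL, ?_⟩
  have h1 : 1 ≤ g.order.toNat := by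
    rw [hord]; obtain ⟨k, hk⟩ := hoddL; omega
  simpa using X_pow_dvd_of_le_order_toNat h1

/-- **`Char X⁺(V/K_∞)^η` VANISHES AT `T = 0` IFF `L_p⁺(V, η, X)` DOES, on every CM row** (same frame; `g(0) = 0 ⟺ Lη(0) = 0`, both being
`1 ≤ ord_T`): the Selmer side detects `L(W, 1) = 0` exactly, by print (k8q-c2 g4's order equality). CONDITIONAL on `h26`, `h22`; nothing booked.
[cite: BurungaleTian2026, Thm. 2.6 (p. 5)] [cite: Kobayashi2003, §4 (p. 8), Thm. 2.2 (p. 5)] -/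
theorem constantCoeff_charGenerator_eq_zero_iff_of_cm
    (h26 : BurungaleTian2026.thm26_etaKatoSequences_charIdeal_upToP_of_cm)
    (h22 : Kobayashi2003.thm22_etaSignedSelmerDual_finite_torsion) (hCM : V.HasCM)
    (hηK : ∀ σ ∈ galRange (K := ℚ) K₀, ηq σ = 1) (hη1 : ηq ≠ 1) (hp5 : 5 ≤ p) (hgood : V.HasGoodReductionAtPrime p)
    (hap : V.frobeniusTrace p = 0) (hf : IsNewformOf V f) (ϖ : ℚ)
    (hϖ : if Even (p / 2) then (ϖ : ℝ) * V.realPeriodRat = plusPeriod f else (ϖ : ℝ) * V.imaginaryPeriodRat = minusPeriod f)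
    {Lη : IwasawaAlgebra p} (hL : IsQuadraticBranchPlusLFunction f p ϖ Lη)
    (hκ : κ.IsCyclotomic) (hγ : κ.IsTopGenerator γ) (hγK : γ ∈ galRange (K := ℚ) K₀) (hγc : IsCyclotomicVariable p γ)
    (D : EtaSignedSelmerDualData V κ K₀ ℚ_[p] ηq γ 1) {g : IwasawaAlgebra p} (hg : D.charIdeal = Ideal.span {g}) :
    PowerSeries.constantCoeff g = 0 ↔ PowerSeries.constantCoeff Lη = 0 := by
  have hp2 : p ≠ 2 := by omega
  have hord : g.order = Lη.order :=
    EtaCMRankOneBT26.order_charGenerator_eq_order_of_cm h26 h22 hCM hηK hη1 hp2 hgood hap hf ϖ hϖ Lη hL hκ hγ hγK hγc D hg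
  have key : ∀ F : IwasawaAlgebra p, PowerSeries.constantCoeff F = 0 ↔ 1 ≤ F.order := fun F ↦ by
    rw [← PowerSeries.coeff_zero_eq_constantCoeff_apply]
    constructor
    · intro h
      refine PowerSeries.nat_le_order F 1 fun i hi ↦ ?_
      have hi0 : i = 0 := by omega
      subst hi0; exact h
    · intro h
      exact PowerSeries.coeff_of_lt_order 0 (lt_of_lt_of_le (by exact_mod_cast Nat.zero_lt_one) h)
  rw [key, key, hord]

end CM

end Summit.BirchSwinnertonDyer.BirchSwinnertonDyer.Theorems.EtaThetaFunctionalEquation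

end
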